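import Literature.MathematicalPhysics.QuantumFieldTheory.Balaban1983to89.B5FromB4

/-!
# B5 ← B4, the edge «In paper [2] we have proved all the necessary properties of G′» with B4's Theorem consumed
# ONLY ON `0 ≤ α < 1` — the range (1.111) prints — : `ThmDepPrintedNN`, `firstOrderGp_of_B4NN`, `prop12G0_of_B4NN`

statement-level skeleton of published theorems with citation tags; proofs where landed; nothing here is a claim about the
Yang–Mills mass gap

B4 = T. Bałaban, *Regularity and decay of lattice Green's functions*, Commun. Math. Phys. **89** (1983) 571–597
[cite: Balaban1983RegularityDecay]; B5 = T. Bałaban, *Propagators and renormalization transformations for lattice gauge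
theories. I*, Commun. Math. Phys. **95** (1984) 17–40 [cite: Balaban1984PropagatorsI].  Cell `lit-balaban` (Phase-2 proof
seat p38 gen 4), file F4a of the programme «[2]'s Theorem on the torus at A = 0» (HOME `ROWS-B5.md`, row B5.Prop1.2, census
item (i) `hThm`; owner r02).

## WHY THIS FILE EXISTS (one paragraph)

`B5FromB4.firstOrderGp_of_B4` — the kernel-checked edge «(1.110)–(1.111) for G′ from [2]» — takes B4's Theorem p. 573 in the
typed shape `B5FromB4.ThmDepPrinted fam₄` (`∀ α < 1`, no floor).  Its PROOF uses the B4 bound at `α = 0` (the sup entries) and at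
the given `0 ≤ α < 1` (the Hölder entry (1.111), which B5 prints for «0 ≤ α < 1», p. 35) — never at a negative `α`.  On the
other hand the `α < 0` instances of the floor-less typed leaf are FALSE on every family containing arbitrarily large volumes
(the Hölder weight `|x − x′|^{|α|}` is unbounded; box refutation `B4Thm19ZeroBoxNegAlpha.not_thmPrinted_boxFam`), so the concrete
zero-field torus family of the Prop. 1.2 programme can only deliver the theorem with the floor `0 ≤ α`.  This file records the
floored hypothesis `ThmDepPrintedNN` (the printed constant dependence: `δ₀, R₀` before `α`; `c₀, e₁` after) and re-runs the
edge with it: **`firstOrderGp_of_B4NN`** (same conclusion `B5FromB4.FirstOrderFam famGp`, same dictionary, same residual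
hypothesis), and the two compositions of `B5FromB4` above it (`prop12G0_of_B4NN`, `prop12_of_B4NN`).  Nothing else changes; the
floor-less hypothesis implies the floored one (`thmDepPrintedNN_of_dep`), so every user of the old edge is a user of the new.

## WHAT IS PRINTED

* B4 p. 573 [PDF 3]: «**Theorem** (Proposition 2.1 of [1]). For α < 1 there exist positive constants δ₀, c₀, R₀ independent of A,
  k, Ω and depending on d, M only, c₀ on α also, such that for e sufficiently small … (1.9) … (1.10) … (1.11) … (1.12).»
* B5 p. 35 [PDF 19], (1.111): «‖ζ∇G J‖_α, ‖ζG∇^*J‖_α ≤ O(1)e^{−δ₀|y−y′|}(‖ζ‖_α + |ζ|)|J| … for 0 ≤ α < 1»; p. 39 [PDF 23]: «The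
  operators G′_k were investigated in paper [2] … In paper [2] we have proved all the necessary properties of G′, except the
  second order inequalities.»

## HONEST SCOPE

`ThmDepPrintedNN` is `B5FromB4.ThmDepPrinted` VERBATIM with the single added binder `0 ≤ α` (cf. the box-side
`B4Ineq111ZeroNestEta.ThmPrintedNN`, the same restriction of b04's coarser `B4.ThmPrinted`).  The proofs of §2 are those of
`B5FromB4` line by line (the `α`-dependent constant is read through `if 0 ≤ α ∧ α < 1`).  No torus, no model: the concrete family
discharging `ThmDepPrintedNN` is the sequel `B4ThmZeroTorusEta`.
-/

namespace Literature.MathematicalPhysics.QuantumFieldTheory.Balaban1983to89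

namespace B5FromB4NN

open B5FromB4

variable {I I₄ : Type}

/-! ## §1 B4's Theorem p. 573, printed dependence, Hölder exponent `0 ≤ α < 1` -/

/-- **B4 Theorem p. 573 with the printed constant dependence AND THE FLOOR `0 ≤ α`**: *"For α < 1 there exist positive constants
δ₀, c₀, R₀ independent of A, k, Ω and depending on d, M only, c₀ on α also, such that for e sufficiently small … (1.9) … (1.10) …
(1.11) … (1.12)"* — `δ₀, R₀` before `α`, `c₀` and the threshold `e₁` after it (`B5FromB4.ThmDepPrinted`), with the Hölder
exponent restricted to `0 ≤ α < 1`, the range on which B5 consumes it ((1.111): «for 0 ≤ α < 1»).  The floor-less typing has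
false `α < 0` instances on large volumes (`B4Thm19ZeroBoxNegAlpha`). [cite: Balaban1983RegularityDecay, Theorem (1.9)–(1.12)
p.573; Balaban1984PropagatorsI, (1.111) p.35] -/
def ThmDepPrintedNN (fam : I₄ → B4.EtaSetting) : Prop :=
  ∃ δ₀ R₀ : ℝ, 0 < δ₀ ∧ 0 < R₀ ∧ ∀ α : ℝ, 0 ≤ α → α < 1 → ∃ c₀ e₁ : ℝ, 0 < c₀ ∧ 0 < e₁ ∧ ∀ i : I₄,
    (fam i).regular → (fam i).bigBlocks → 0 < (fam i).e → (fam i).e ≤ e₁ →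
      B4.Ineq19_110 (fam i) α δ₀ c₀ R₀ ∧ B4.Ineq111_112 (fam i) α δ₀ c₀ R₀

/-- The floor-less typed statement implies the floored one (so `ThmDepPrintedNN` is a weakening of the cell's hypothesis, not a
new statement). [cite: Balaban1983RegularityDecay, Theorem p.573; bookkeeping] -/
theorem thmDepPrintedNN_of_dep (fam : I₄ → B4.EtaSetting) (h : ThmDepPrinted fam) : ThmDepPrintedNN fam := by
  obtain ⟨δ₀, R₀, hδ, hR, H⟩ := h
  exact ⟨δ₀, R₀, hδ, hR, fun α _ hα1 => H α hα1⟩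

/-- The floored statement in b04's coarser quantifier order (`∀ α ∃ δ₀ c₀ R₀ e₁`), i.e. the shape of
`B4Ineq111ZeroNestEta.ThmPrintedNN`, unfolded. [cite: Balaban1983RegularityDecay, Theorem p.573; bookkeeping] -/
theorem thmPrintedNN_of_depNN (fam : I₄ → B4.EtaSetting) (h : ThmDepPrintedNN fam) :
    ∀ α : ℝ, 0 ≤ α → α < 1 → ∃ δ₀ c₀ R₀ e₁ : ℝ, 0 < δ₀ ∧ 0 < c₀ ∧ 0 < R₀ ∧ 0 < e₁ ∧ ∀ i : I₄,
      (fam i).regular → (fam i).bigBlocks → 0 < (fam i).e → (fam i).e ≤ e₁ →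
        B4.Ineq19_110 (fam i) α δ₀ c₀ R₀ ∧ B4.Ineq111_112 (fam i) α δ₀ c₀ R₀ := by
  obtain ⟨δ₀, R₀, hδ, hR, H⟩ := h
  intro α hα0 hα1
  obtain ⟨c₀, e₁, hc, he, H'⟩ := H α hα0 hα1
  exact ⟨δ₀, c₀, R₀, e₁, hδ, hc, hR, he, H'⟩

/-! ## §2 The edge theorem with the floored hypothesis -/

/-- **(1.110)–(1.111) for G′ from [2] consumed on `0 ≤ α < 1` only, kernel-checked** — `B5FromB4.firstOrderGp_of_B4` with
`hThm : ThmDepPrintedNN fam₄`: (1.10) at `α = 0` gives the sup entries `|(G′J)(x)|`, `|(∇G′J)(x)|` with `O(1) = c₀(0)e^{δ₀c}`;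
(1.9) + (1.10) at the given `0 ≤ α < 1` and the product rule give `‖ζ∇G′J‖_α` with `O(1)(α) = 2c₀(α)e^{δ₀c}`; the entries
`|(G′∇*J)(x)|`, `|(ΔG′J)(x)|`, `‖ζG′∇*J‖_α` are the residual hypothesis; rates merged by `min`, constants by `max`; for each
`α` the threshold `e₁(α)` is met by the dictionary's instance of charge `e₁(α)`.  The proof is that of `firstOrderGp_of_B4`,
which never used a negative `α`. [cite: Balaban1984PropagatorsI, p.39 «In paper [2] we have proved all the necessary properties of
G′», (1.110)–(1.111) p.35 («for 0 ≤ α < 1»)] -/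
theorem firstOrderGp_of_B4NN (fam₄ : I₄ → B4.EtaSetting) (famGp : I → B5.Setting)
    (F : ∀ i, GpHolder (famGp i)) (c : ℝ) (ι : I → ℝ → I₄)
    (D : ∀ (i : I) (e : ℝ), 0 < e → Dict (fam₄ (ι i e)) (famGp i) (F i) c e)
    (Sg : ∀ i, ModelSigns (famGp i))
    (hThm : ThmDepPrintedNN fam₄) (hRes : ResidualGpFirst famGp F) : FirstOrderFam famGp := by
  obtain ⟨δ₄, R₀, hδ₄, hR₀, H⟩ := hThm
  choose c₀ e₁ Hc using H
  obtain ⟨δr, Cr, Cαr, hδr, hCr, Hr⟩ := hRes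
  have h00 : (0 : ℝ) ≤ 0 := le_rfl
  have h01 : (0 : ℝ) < 1 := zero_lt_one
  -- B4 at exponent 0 ≤ α < 1 for the member i, through the dictionary's instance of charge e₁(α)
  have B4at : ∀ (α : ℝ) (hα0 : 0 ≤ α) (hα : α < 1) (i : I),
      B4.Ineq19_110 (fam₄ (ι i (e₁ α hα0 hα))) α δ₄ (c₀ α hα0 hα) R₀ := by
    intro α hα0 hα i
    obtain ⟨hc0, he1, HP⟩ := Hc α hα0 hα
    have Di := D i (e₁ α hα0 hα) he1
    exact (HP (ι i (e₁ α hα0 hα)) Di.regular Di.bigBlocks (lt_of_lt_of_eq he1 Di.charge.symm)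
      (le_of_eq Di.charge)).1
  have hc00 : 0 < c₀ 0 h00 h01 := (Hc 0 h00 h01).1
  -- merged constants
  obtain ⟨δ₀, hδ₀, hd4, hdr⟩ : ∃ δ₀ : ℝ, 0 < δ₀ ∧ δ₀ ≤ δ₄ ∧ δ₀ ≤ δr :=
    ⟨min δ₄ δr, lt_min hδ₄ hδr, min_le_left _ _, min_le_right _ _⟩
  obtain ⟨C, hC, hC4, hCr'⟩ : ∃ C : ℝ, 0 < C ∧ c₀ 0 h00 h01 * Real.exp (δ₄ * c) ≤ C ∧ Cr ≤ C :=
    ⟨max (c₀ 0 h00 h01 * Real.exp (δ₄ * c)) Cr, lt_max_of_lt_right hCr, le_max_left _ _, le_max_right _ _⟩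
  refine ⟨δ₀, C, fun α => if hα : 0 ≤ α ∧ α < 1 then
      max (max (2 * c₀ α hα.1 hα.2 * Real.exp (δ₄ * c)) (Cαr α)) 0 else 0,
    hδ₀, hC, fun i => ⟨?_, ?_⟩⟩
  · -- the four sup entries: n = 0, 1 from B4 (1.10) at α = 0; n = 2, 3 residual
    have Sgi := Sg i
    obtain ⟨Hr2, Hr3, -⟩ := Hr i
    have Di := D i (e₁ 0 h00 h01) (Hc 0 h00 h01).2.1
    have B0 := B4at 0 h00 h01 i
    refine supEntry_all ?_ ?_ ?_ ?_
    · intro J y y' hs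
      have key : (famGp i).e 0 J y ≤ c₀ 0 h00 h01 * Real.exp (δ₄ * c) *
          Real.exp (-(δ₄ * (famGp i).dist y y')) * (famGp i).supNorm J :=
        Di.e0_le J y _ fun x hx =>
          pointwise_to_cube (B0.2 Di.dir (Di.loc J) x (Or.inl Di.rect)).2 hc00.le hδ₄.le
            (Di.geom1 x y J y' hx hs) (Di.supNorm_le J) (Sgi.supNorm_nonneg J)
      exact B9FromB6.weaken3 key hC4 hC.le (Sgi.supNorm_nonneg J) hd4 (Sgi.dist_nonneg y y')
    · intro J y y' hs
      have key : (famGp i).e 1 J y ≤ c₀ 0 h00 h01 * Real.exp (δ₄ * c) *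
          Real.exp (-(δ₄ * (famGp i).dist y y')) * (famGp i).supNorm J :=
        Di.e1_le J y _ fun μ x hx =>
          pointwise_to_cube (B0.2 μ (Di.loc J) x (Or.inl Di.rect)).1 hc00.le hδ₄.le
            (Di.geom1 x y J y' hx hs) (Di.supNorm_le J) (Sgi.supNorm_nonneg J)
      exact B9FromB6.weaken3 key hC4 hC.le (Sgi.supNorm_nonneg J) hd4 (Sgi.dist_nonneg y y')
    · intro J y y' hs
      exact B9FromB6.weaken3 (Hr2 J y y' hs) hCr' hC.le (Sgi.supNorm_nonneg J) hdr (Sgi.dist_nonneg y y')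
    · intro J y y' hs
      exact B9FromB6.weaken3 (Hr3 J y y' hs) hCr' hC.le (Sgi.supNorm_nonneg J) hdr (Sgi.dist_nonneg y y')
  · -- the Hölder entry (1.111): the ∇G′ half ⇐ (1.9), (1.10), product rule; the G′∇* half residual
    have Sgi := Sg i
    obtain ⟨-, -, HrS⟩ := Hr i
    intro α J ζ y y' hα0 hα1 hζ hs
    obtain ⟨hcα, heα, -⟩ := Hc α hα0 hα1
    have Di := D i (e₁ α hα0 hα1) heα
    have B := B4at α hα0 hα1 i
    have hb0 : 0 ≤ c₀ α hα0 hα1 * Real.exp (δ₄ * c) * Real.exp (-(δ₄ * (famGp i).dist y y')) *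
        (famGp i).supNorm J :=
      mul_nonneg (mul_nonneg (mul_nonneg hcα.le (Real.exp_nonneg _)) (Real.exp_nonneg _))
        (Sgi.supNorm_nonneg J)
    have hD : (F i).hD J α ζ ≤ (famGp i).cutH α ζ *
        (c₀ α hα0 hα1 * Real.exp (δ₄ * c) * Real.exp (-(δ₄ * (famGp i).dist y y')) * (famGp i).supNorm J +
          c₀ α hα0 hα1 * Real.exp (δ₄ * c) * Real.exp (-(δ₄ * (famGp i).dist y y')) * (famGp i).supNorm J) := by
      refine Di.hD_le J α ζ y _ _ hζ hb0 hb0 ?_ ?_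
      · intro μ x x' hxx
        exact pointwise_to_cube (B.1 μ (Di.loc J) x x' (Or.inl Di.rect)) hcα.le hδ₄.le
          (Di.geom2 x x' y J y' hxx hs) (Di.supNorm_le J) (Sgi.supNorm_nonneg J)
      · intro μ x hx
        exact pointwise_to_cube (B.2 μ (Di.loc J) x (Or.inl Di.rect)).1 hcα.le hδ₄.le
          (Di.geom1 x y J y' hx hs) (Di.supNorm_le J) (Sgi.supNorm_nonneg J)
    have hD' : (F i).hD J α ζ ≤ 2 * c₀ α hα0 hα1 * Real.exp (δ₄ * c) *
        Real.exp (-(δ₄ * (famGp i).dist y y')) * (famGp i).cutH α ζ * (famGp i).supNorm J := by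
      refine hD.trans (le_of_eq ?_)
      ring
    have hαα : 0 ≤ α ∧ α < 1 := ⟨hα0, hα1⟩
    have hCα : (if hα : 0 ≤ α ∧ α < 1 then
        max (max (2 * c₀ α hα.1 hα.2 * Real.exp (δ₄ * c)) (Cαr α)) 0 else 0) =
          max (max (2 * c₀ α hα0 hα1 * Real.exp (δ₄ * c)) (Cαr α)) 0 := dif_pos hαα
    dsimp only
    rw [hCα]
    have hCα0 : 0 ≤ max (max (2 * c₀ α hα0 hα1 * Real.exp (δ₄ * c)) (Cαr α)) 0 := le_max_right _ _
    have hD'' := weaken4 hD'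
      ((le_max_left _ _).trans (le_max_left _ _) :
        2 * c₀ α hα0 hα1 * Real.exp (δ₄ * c) ≤ max (max (2 * c₀ α hα0 hα1 * Real.exp (δ₄ * c)) (Cαr α)) 0)
      hCα0 (Sgi.cutH_nonneg α ζ) (Sgi.supNorm_nonneg J) hd4 (Sgi.dist_nonneg y y')
    have hS'' := weaken4 (HrS α J ζ y y' hα0 hα1 hζ hs)
      ((le_max_right _ _).trans (le_max_left _ _) :
        Cαr α ≤ max (max (2 * c₀ α hα0 hα1 * Real.exp (δ₄ * c)) (Cαr α)) 0)
      hCα0 (Sgi.cutH_nonneg α ζ) (Sgi.supNorm_nonneg J) hdr (Sgi.dist_nonneg y y')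
    exact ((F i).h1_le J α ζ).trans (max_le hD'' hS'')

/-! ## §3 The two compositions of `B5FromB4` above the edge, with the floored hypothesis -/

/-- **S3 from [2] = B4, the edge composed, floored hypothesis** — `B5FromB4.prop12G0_of_B4` with `hThm : ThmDepPrintedNN fam₄`:
B4's Theorem (printed dependence, `0 ≤ α < 1`) through the dictionary gives the printed half of the first-order entries of G′
(`firstOrderGp_of_B4NN`), B4's Lemma 2.4 feeds (1.135)–(1.137) (`h137`), and the passage's remaining sentences are the named
hypotheses. [cite: Balaban1984PropagatorsI, pp.39–40] -/
theorem prop12G0_of_B4NN {I₂₄ : Type} (fam₄ : I₄ → B4.EtaSetting) (fam₂₄ : I₂₄ → B4.ScaleSetting)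
    (famGp famG0 : I → B5.Setting) (F : ∀ i, GpHolder (famGp i)) (c : ℝ) (ι : I → ℝ → I₄)
    (D : ∀ (i : I) (e : ℝ), 0 < e → Dict (fam₄ (ι i e)) (famGp i) (F i) c e)
    (SgGp : ∀ i, ModelSigns (famGp i)) (SgG0 : ∀ i, ModelSigns (famG0 i))
    (hThm : ThmDepPrintedNN fam₄) (h24 : B4.Lemma24Printed fam₂₄)
    (hRes : ResidualGpFirst famGp F)
    (h137 : B4.Lemma24Printed fam₂₄ → SecondOrderFam famGp)
    (h11G0 : B5.Prop11Printed famG0)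
    (h114G0 : B5.Prop11Printed famG0 → B5.Local114Fam famG0)
    (transfer : FirstOrderFam famGp → SecondOrderFam famGp → B5.Local114Fam famG0 →
      FirstOrderFam famG0 ∧ SecondOrderFam famG0) :
    B5.Prop12Printed famG0 :=
  prop12G0_of_printed_steps famGp famG0 SgG0 h11G0 h114G0
    (firstOrderGp_of_B4NN fam₄ famGp F c ι D SgGp hThm hRes) (h137 h24) transfer

/-- **Prop. 1.2 with its [2]-import explicit, floored hypothesis** — `B5FromB4.prop12_of_B4` with `hThm : ThmDepPrintedNN fam₄`
(`S3 : B5.Prop12Printed famG0` discharged by `prop12G0_of_B4NN`; every other step keeps its shape).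
[cite: Balaban1984PropagatorsI, pp.36–40] -/
theorem prop12_of_B4NN {I₂₄ : Type} (fam₄ : I₄ → B4.EtaSetting) (fam₂₄ : I₂₄ → B4.ScaleSetting)
    (fam famGp famG0 : I → B5.Setting) (g : ∀ i, B5.GlobalH (fam i)) (K : I → B5.KernelData)
    (F : ∀ i, GpHolder (famGp i)) (c : ℝ) (ι : I → ℝ → I₄)
    (D : ∀ (i : I) (e : ℝ), 0 < e → Dict (fam₄ (ι i e)) (famGp i) (F i) c e)
    (SgGp : ∀ i, ModelSigns (famGp i)) (SgG0 : ∀ i, ModelSigns (famG0 i))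
    (hThm : ThmDepPrintedNN fam₄) (h24 : B4.Lemma24Printed fam₂₄)
    (hRes : ResidualGpFirst famGp F)
    (h137 : B4.Lemma24Printed fam₂₄ → SecondOrderFam famGp)
    (h11G0 : B5.Prop11Printed famG0)
    (h114G0 : B5.Prop11Printed famG0 → B5.Local114Fam famG0)
    (transfer : FirstOrderFam famGp → SecondOrderFam famGp → B5.Local114Fam famG0 →
      FirstOrderFam famG0 ∧ SecondOrderFam famG0)
    (h11 : B5.Prop11Printed fam) (hleaf : B5.Kernel126_127Printed K)
    (S1' : B5.Prop11Printed fam → B5.Kernel126_127Printed K → B5.Local114Fam fam)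
    (S2 : B5.Prop12Printed famG0 → B5.Kernel126_127Printed K → B5.Local114Fam fam →
      B5.Global115_117Fam fam g)
    (S1 : B5.Global115_117Fam fam g → B5.Prop11Printed fam → B5.Kernel126_127Printed K →
      B5.Prop12Printed fam) :
    B5.Prop12Printed fam :=
  B5.prop12_of_printed_steps fam famG0 g K h11 hleaf S1'
    (prop12G0_of_B4NN fam₄ fam₂₄ famGp famG0 F c ι D SgGp SgG0 hThm h24 hRes h137 h11G0 h114G0 transfer) S2 S1

end B5FromB4NN

end Literature.MathematicalPhysics.QuantumFieldTheory.Balaban1983to89
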